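import Mathlib
import HarnessLib
import Literature.Computability.AlgebraicComplexity.PatternExpressions
import Literature.Computability.AlgebraicComplexity.StandardFamilies

/-!
# The rank-one shadow of homomorphism polynomials: `hom_{F,n}(u vᵀ)` is a product of power sums

Route MonotoneRestoration, item `OrbitRestorationLinearVolumeQP` (stmt-ValiantsHypothesis-18294; its hypothesis class is
"`f n = Σ_{i<m_n} α_{n,i} · homPoly (E n i) n ℂ`, `m_n ≤ (n+2)^c`").  The item's informal statement asserts that the class
EXCLUDES THE PERMANENT because the homomorphism expansion of `per_n` charges super-polynomially many patterns (there: via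
Möbius inversion over quotient patterns).  This file lands the computational heart of a shorter route to that calibration,
the RANK-ONE SHADOW: substituting the rank-one matrix `x_ij ↦ u_i v_j` (the algebra map
`bind₁ (fun (i,j) => u_i * v_j)` into `K[u_i, v_j] = MvPolynomial (Fin n ⊕ Fin n) K`, `u_i = X (inl i)`, `v_j = X (inr j)`),

* `rankOne_homPoly` — `hom_{F,n}(u vᵀ) = Π_{a ∈ A} p_{deg a}(u) · Π_{b ∈ B} p_{deg b}(v)`, a product of POWER SUMS
  `p_d(u) = Σ_i u_i^d` indexed by the degree sequence of the pattern (isolated vertices give `p_0 = n`);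
* `rankOne_perPoly` — `per_n(u vᵀ) = n! · Π_i u_i · Π_j v_j = n! · e_n(u) e_n(v)`.

Consequently a representation `per_n = Σ_{i<m} α_i hom_{F_i,n}` forces `e_n(u)·e_n(v)` into the span of `m` products of
power-sum products, so `m ≥ p(n)` (the number of partitions of `n`) by the linear independence of the power-sum products
`p_λ`, `λ ⊢ n`, in `n` variables and the full support of `e_n = Σ_{λ ⊢ n} ε_λ z_λ⁻¹ p_λ` — that last step (classical
symmetric-function theory) is NOT in the tree and is not proved here.

Honest framing: helper identities for an OPEN item; nothing here is progress on `VP ≠ VNP`.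
[cite: DwivediPagoSeppelt2026, eq. (1)]
-/

noncomputable section

open MvPolynomial

-- `Summit.ValiantsHypothesis.ValiantsHypothesis.…` is the tree's single-conjunct layout (Sub = Summit).
set_option linter.dupNamespace false

namespace Summit.ValiantsHypothesis.ValiantsHypothesis.Theorems

namespace RankOneShadow

open Literature.Computability.AlgebraicComplexity

universe u

variable {K : Type*} [CommSemiring K]

/-- A multiset product of values `Y (f e)` is the product over the (finite) index type of `Y a ^ #{e : f e = a}`.
[folklore] -/
theorem prod_map_eq_prod_pow_count {τ A : Type*} [Fintype A] [DecidableEq A] {M : Type*} [CommMonoid M]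
    (E : Multiset τ) (f : τ → A) (Y : A → M) :
    (E.map fun e => Y (f e)).prod = ∏ a : A, Y a ^ (E.map f).count a := by
  rw [show (E.map fun e => Y (f e)) = (E.map f).map Y by rw [Multiset.map_map]; rfl,
    Finset.prod_multiset_map_count]
  refine Finset.prod_subset (Finset.subset_univ _) fun a _ ha => ?_
  rw [Multiset.count_eq_zero_of_notMem (mt Multiset.mem_toFinset.2 ha), pow_zero]

/-- Summing a product of per-vertex factors over all vertex maps: `Σ_{h : A → Fin n} Π_a Y a (h a) = Π_a Σ_i Y a i`.
[folklore] -/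
theorem sum_prod_eq_prod_sum {A : Type*} [Fintype A] [DecidableEq A] {R : Type*} [CommSemiring R] (n : ℕ)
    (Y : A → Fin n → R) : ∑ h : A → Fin n, ∏ a : A, Y a (h a) = ∏ a : A, ∑ i : Fin n, Y a i := by
  rw [Finset.prod_univ_sum]
  simp only [Fintype.piFinset_univ]

/-- **The rank-one shadow of a homomorphism polynomial**: `hom_{F,n}(u vᵀ) = Π_{a} p_{deg a}(u) · Π_{b} p_{deg b}(v)`.
[cite: DwivediPagoSeppelt2026, eq. (1)] -/
theorem rankOne_homPoly {A B : Type u} [Fintype A] [DecidableEq A] [Fintype B] [DecidableEq B]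
    (E : Multiset (A × B)) (n : ℕ) :
    bind₁ (fun p : Fin n × Fin n => (X (Sum.inl p.1) * X (Sum.inr p.2) : MvPolynomial (Fin n ⊕ Fin n) K)) (homPoly E n K) =
      (∏ a : A, ∑ i : Fin n, X (Sum.inl i) ^ (E.map Prod.fst).count a) *
        ∏ b : B, ∑ j : Fin n, X (Sum.inr j) ^ (E.map Prod.snd).count b := by
  unfold homPoly
  rw [map_sum]
  have hterm : ∀ h : (A → Fin n) × (B → Fin n),
      bind₁ (fun p : Fin n × Fin n => (X (Sum.inl p.1) * X (Sum.inr p.2) : MvPolynomial (Fin n ⊕ Fin n) K)) ((E.map fun e => (X (h.1 e.1, h.2 e.2) : MvPolynomial (Fin n × Fin n) K)).prod) =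
        (∏ a : A, X (Sum.inl (h.1 a)) ^ (E.map Prod.fst).count a) *
          ∏ b : B, X (Sum.inr (h.2 b)) ^ (E.map Prod.snd).count b := by
    intro h
    rw [map_multiset_prod, Multiset.map_map]
    simp only [Function.comp_def, bind₁_X_right]
    rw [Multiset.prod_map_mul,
      prod_map_eq_prod_pow_count E (fun e => e.1) fun a => (X (Sum.inl (h.1 a)) : MvPolynomial (Fin n ⊕ Fin n) K),
      prod_map_eq_prod_pow_count E (fun e => e.2) fun b => (X (Sum.inr (h.2 b)) : MvPolynomial (Fin n ⊕ Fin n) K)]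
  simp only [hterm]
  rw [Fintype.sum_prod_type]
  simp only [Finset.prod_univ_sum, Fintype.piFinset_univ, Finset.sum_mul_sum]

/-- **The rank-one shadow of the permanent**: `per_n(u vᵀ) = n! · Π_i u_i · Π_j v_j`. [folklore] -/
theorem rankOne_perPoly (n : ℕ) :
    bind₁ (fun p : Fin n × Fin n => (X (Sum.inl p.1) * X (Sum.inr p.2) : MvPolynomial (Fin n ⊕ Fin n) K)) (perPoly (Fin n) K) = n.factorial • ((∏ i : Fin n, X (Sum.inl i)) * ∏ j : Fin n, X (Sum.inr j)) := by
  classical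
  simp only [perPoly, Matrix.permanent, Matrix.mvPolynomialX_apply, map_sum, map_prod, bind₁_X_right]
  have hσ : ∀ σ : Equiv.Perm (Fin n),
      ∏ i : Fin n, (X (Sum.inl (σ i)) : MvPolynomial (Fin n ⊕ Fin n) K) * X (Sum.inr i) =
        (∏ i : Fin n, X (Sum.inl i)) * ∏ j : Fin n, X (Sum.inr j) := by
    intro σ
    rw [Finset.prod_mul_distrib]
    congr 1
    exact Equiv.prod_comp σ fun i => (X (Sum.inl i) : MvPolynomial (Fin n ⊕ Fin n) K)
  simp only [hσ, Finset.sum_const, Finset.card_univ, Fintype.card_perm, Fintype.card_fin]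

end RankOneShadow

end Summit.ValiantsHypothesis.ValiantsHypothesis.Theorems

end
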